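import Literature.MathematicalPhysics.QuantumFieldTheory.Balaban1983to89.Node00.Record13CoP
import Literature.MathematicalPhysics.QuantumFieldTheory.Balaban1983to89.Node00.DomainsGenSetBridge
import Literature.MathematicalPhysics.QuantumFieldTheory.Balaban1983to89.Node00.LargeFieldBackgroundCoPOfRecordB
import Summits.QuantumFields.YangMills.Theorems.BalabanUVNodesN11BackgroundCoPMeasurableB

/-!
# DAG node N11 — (BL) SCALE-LOCALITY OF def-R's SUPPORT-EDITION BACKGROUND: the level-`k` background of a sequence of record `U_k(s)(𝐖)` reads the
# multi-scale variables `𝐖 = {W_i}` only at the scales `i ≤ k` — by the tree's predicate-fed typing of the (2.12) solution map (`UminOfRecord` is a function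
# of the predicate `IsMinimizer … 𝐖`, which reads `𝐖` on the determining set `𝐁({Ω_j}) = genSet Ω k`, empty above scale `k`)

Cell `pub-ymgap`, YM-PLAN Track A (HUMAN RULING D-0062), seat `pub-ymgap-dag-n11-d` (g7; R134 fan-out seat N11 [B14], strategy s2), route `BalabanUVNodes`
rev 22, item K1⁶ `StabilityBAtRecordR13SepCoPR` = stmt-QuantumFields-20507 (helper, count-neutral).  [III] = [Balaban1988Convergent].  Over r12∕n02's
`B15DeterminingSets` ((2.2) `gammaRegion`∕`genSet`, `AgreeOn`, `IsMinimizer`), def-R's `Node00/SmallFieldChiOfRecord` (`UminOfRecord` v2 — predicate-fed —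
and its face `UminOfRecord_congr_of_isMinimizer_iff₀`), `Node00/LargeFieldBackgroundCoPOfRecord` (22′: `UbgMSCoPOfRecordAt`, `UbgMSCoPOfRecord`) and node00-def-T's
`Node00/Record13CoP` (`UbgOfRecord₁₃CoP`, the background the v1.5∕v1.6∕(v1.7) §2 predicates read — by SITE-RULE at `θ.toStage13Params` in the later editions).

WHY THIS FILE.  The inductive 𝐓-step of (S1ᵀ) over an ARBITRARY history (not only the all-large-field diagonal) needs «the old factors agree» ((3.24)) between the
old operand at the base configuration and the new operand at the two-scale configuration; the configurations agree at the scales `≤ k`, so the step needs the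
level-`k` operand — hence def-R's background `UbgOfRecord₁₃CoP θ p k s 𝐖` inside `e^{A_k(s)(U_k(s)(𝐖))}` — to be `k`-LOCAL in `𝐖`.  This seat's 4c proved it
along the all-large-field history only (there the background is the fine field `𝐖 0`), and listed the general case as «classical-choice congruence, not
typed» — wrongly pessimistic: def-R's v2 solution map is PREDICATE-FED (director-ym LINE №128 route (B)), so it IS a function of the (2.12) predicate, and the
predicate reads `𝐖` only on the bonds of the determining set `genSet s.Ω k`, whose members above scale `k` are empty ((2.2) `gammaRegion_of_gt`).  Hence (BL).
Together with this seat's `…NoExpansionActionSucc` (operand algebra at `Ω_{k+1} = ∅`), `…TkBranchLinearLocal` ((L)+(SL)) and `…TkBranchWeightCongr` ((PC)), this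
is the third of the four typed ingredients of the general no-expansion 𝐓-step a history-indexed residual slot (node00-def-T LOCATED-9, H1ʰ) would make
statable; the fourth — scale-locality of the term-value witness's 𝐁-terms in the fluctuation argument — is a property of `Sect2.TermValues`, displayed when used.

WHAT THIS FILE PROVES (0 `sorry`, 0 `def`, standard axioms; `N`-generic).  `not_mem_bondsOf_genSet_of_lt` (no bond of `genSet Ω k` above scale `k`) ·
`agreeOn_genSet_iff_of_agree_le` · `isMinimizer_genSet_iff_of_agree_le` (the (2.12) predicate for `𝐁({Ω_j}_{j ≤ k})` reads `𝐖` at scales `≤ k`) ·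
★ `UbgMSCoPOfRecordAt_congr_of_agree_le` ∕ `UbgMSCoPOfRecord_congr_of_agree_le` (def-R's backgrounds, on a support ∕ of record) · ★ `UbgOfRecord₁₃CoP_congr_of_agree_le
(θ p n s) (h : ∀ i ≤ n, 𝐖 i = 𝐖′ i) : UbgOfRecord₁₃CoP F N θ p n s 𝐖 = UbgOfRecord₁₃CoP F N θ p n s 𝐖′` (every level `n`, every sequence).

EDITION v1.1 (Stage-2 train, WORKPLAN-IIIB (iii-b), director-ym №343 (D5)∕(D6), row TRAIN-N11, seat dag-n11-d g41): §2 gains the print-datum twins ★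
`UbgMSCoPOfRecordAtB_congr_of_agree_le` ∕ `UbgMSCoPOfRecordB_congr_of_agree_le` (node00-def-R's S2b `Node00.LargeFieldBackgroundCoPOfRecordB` + this seat's
`…N11BackgroundCoPMeasurableB`), and the record-level ★ `UbgOfRecord₁₃CoP_congr_of_agree_le` is re-proved SEAM-ROBUSTLY (`apply_rules` over both (BL) faces): its statement is
byte-identical and it elaborates BEFORE and AFTER the `Record13CoP` seam edit re-points `UbgOfRecord₁₃CoP … (n+1)` to print's datum (FLAG №16 ∕ LOCATE-HSEAM
5d3298b8d191f169); every (b)-statement here stays landed and true.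

HONEST FRAMING.  Kernel bookkeeping on the tree's typing of (2.12) (count-neutral): it says the TOTALISED solution map of record is scale-local, which is a
property of the typing convention (predicate-fed selector, unit junk branch), true whatever [15] Thm 1 says; nothing of Bałaban's asserted ([15] Thm 1 NOT used or
claimed).  N11 NOT discharged; counts unmoved (typed 28∕28 · discharged 5∕28).  One finite four-torus programme at fixed `ε = L^{−K}`; NOT ℝ⁴, NOT OS, NOT a mass
gap, NOT Clay.  Sources: [III] (2.2) p.255, (2.12)–(2.13) pp.256–257, §2 p.258; [Balaban1985Variational] (5)–(6) p.278 (the variational problem, by name).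
-/

noncomputable section

namespace Summit.QuantumFields.YangMills.Theorems.BalabanUVNodesN11BackgroundScaleLocal

open Literature.MathematicalPhysics.QuantumFieldTheory.Balaban1983to89 T4Continuum Node00 Node00.Tk DagBinding
open B15DeterminingSets B15DeterminingSetsB
open Summit.QuantumFields.YangMills.Theorems.BalabanUVNodesN11BackgroundCoPMeasurableB (UminOfRecordB_lamBondsSeq_congr_of_agree_le)

/-! ## §1. The (2.12) predicate for the determining set of `{Ω_j}_{j ≤ k}` reads the data at scales `≤ k` -/

section Predicate

variable {P : Params} {G : Type*} [GaugeGroup G]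

/-- **NO BOND OF `𝐁({Ω_j}_{j ≤ k})` LIES ABOVE SCALE `k`** ((2.2): `Γ_i = ∅` for `i > k`).  v1.1: DEPRECATED ALIAS of the tree's `Node00.not_mem_bondsOf_genSet_of_gt`
(`Node00/DomainsGenSetBridge`, the same statement landed Literature-side) — one declarer; the name is kept (append-only). [cite: Balaban1988Convergent, (2.2) p.255] -/
@[deprecated not_mem_bondsOf_genSet_of_gt (since := "2026-08-30")]
alias not_mem_bondsOf_genSet_of_lt := not_mem_bondsOf_genSet_of_gt

omit [GaugeGroup G] in
/-- **AGREEMENT ON `𝐁({Ω_j}_{j ≤ k})` READS THE DATA AT SCALES `≤ k`**: two multi-scale data equal at every scale `i ≤ k` agree with the same fields on the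
determining set. [cite: Balaban1988Convergent, (2.2) p.255, (2.12) p.256] -/
theorem agreeOn_genSet_iff_of_agree_le (Ω : ℕ → Set (Site P 0)) (k : ℕ) {W W' : MSField P G} (h : ∀ i, i ≤ k → W i = W' i) (f : MSField P G) :
    AgreeOn (genSet Ω k) f W ↔ AgreeOn (genSet Ω k) f W' := by
  unfold AgreeOn
  refine forall_congr' fun i => forall_congr' fun b => forall_congr' fun hb => ?_
  rcases le_or_gt i k with hi | hi
  · rw [h i hi]
  · exact absurd hb (not_mem_bondsOf_genSet_of_gt Ω hi b)

/-- **THE (2.12) PREDICATE FOR `𝐁({Ω_j}_{j ≤ k})` READS THE DATA AT SCALES `≤ k`.** [cite: Balaban1988Convergent, (2.12) p.256, (2.2) p.255] -/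
theorem isMinimizer_genSet_iff_of_agree_le (av : ∀ j, Averaging P j G) (reg : Set (GaugeField P 0 G)) (Ω : ℕ → Set (Site P 0)) (k : ℕ)
    {W W' : MSField P G} (h : ∀ i, i ≤ k → W i = W' i) (U₀ : GaugeField P 0 G) :
    IsMinimizer av reg (genSet Ω k) W U₀ ↔ IsMinimizer av reg (genSet Ω k) W' U₀ := by
  unfold IsMinimizer
  simp only [agreeOn_genSet_iff_of_agree_le Ω k h]

end Predicate

/-! ## §2. ★ def-R's backgrounds of a sequence are scale-local; hence node00-def-T's `UbgOfRecord₁₃CoP` at every level -/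

section Background

variable {F : T4Family} {N : ℕ} [NeZero N]

/-- **★ (BL) ON A SUPPORT**: def-R's background of a sequence of length `k` on the support `Ω₀` reads `𝐖` at the scales `≤ k` only (the solution map of record
is a function of the (2.12) predicate — `UminOfRecord_congr_of_isMinimizer_iff₀` — and the predicate reads `𝐖` on `genSet s.Ω k`).
[cite: Balaban1988Convergent, (2.12)–(2.13) pp.256–257, (2.2) p.255] -/
theorem UbgMSCoPOfRecordAt_congr_of_agree_le (ν : Stage7Numerics) (M : ℕ) (g : ℕ → ℝ) (K k : ℕ) (Ω₀ : Set (Site (F.P K) 0))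
    (s : SeqOfRecord F ν M g K k) {W W' : MSField (F.P K) (SU N)} (h : ∀ i, i ≤ k → W i = W' i) :
    UbgMSCoPOfRecordAt F N ν M g K k Ω₀ s W = UbgMSCoPOfRecordAt F N ν M g K k Ω₀ s W' := by
  rw [UbgMSCoPOfRecordAt_apply, UbgMSCoPOfRecordAt_apply]
  exact UminOfRecord_congr_of_isMinimizer_iff₀ _ _ fun U₀ => isMinimizer_genSet_iff_of_agree_le _ _ s.Ω k h U₀

/-- **★ (BL) OF RECORD**: def-R's support-edition background of a sequence of length `k` reads `𝐖` at the scales `≤ k` only.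
[cite: Balaban1988Convergent, (2.12)–(2.13) pp.256–257, (2.2) p.255] -/
theorem UbgMSCoPOfRecord_congr_of_agree_le (ν : Stage7Numerics) (M : ℕ) (g : ℕ → ℝ) (K k : ℕ) (s : SeqOfRecord F ν M g K k)
    {W W' : MSField (F.P K) (SU N)} (h : ∀ i, i ≤ k → W i = W' i) :
    UbgMSCoPOfRecord F N ν M g K k s W = UbgMSCoPOfRecord F N ν M g K k s W' := by
  rw [UbgMSCoPOfRecord_apply, UbgMSCoPOfRecord_apply]
  exact UminOfRecord_congr_of_isMinimizer_iff₀ _ _ fun U₀ => isMinimizer_genSet_iff_of_agree_le _ _ s.Ω k h U₀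

/-- **★ (BL) FOR def-R's PRINT-DATUM BACKGROUND ON A SUPPORT** over `Λ({Ω_j(s)}) = lamBondsSeq s.Ω k`: `U_k(s)(𝐖)` reads `𝐖` at scales `≤ k` only — print-datum twin of
`UbgMSCoPOfRecordAt_congr_of_agree_le` (FLAG №16 ∕ LOCATE-HSEAM 5d3298b8d191f169; the (b)-instance stays landed and true on its own text, just above): node00-def-R's S2b
`UbgMSCoPOfRecordAtB_apply` + `…N11BackgroundCoPMeasurableB.UminOfRecordB_lamBondsSeq_congr_of_agree_le`.
[cite: Balaban1988Convergent, (2.12)–(2.13) pp.256–257; Balaban1985Variational, (2), (5)–(6) p.278; Balaban1984PropagatorsII, (2.3) p.224] -/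
theorem UbgMSCoPOfRecordAtB_congr_of_agree_le (ν : Stage7Numerics) (M : ℕ) (g : ℕ → ℝ) (K k : ℕ) (Ω₀ : Set (Site (F.P K) 0))
    (s : SeqOfRecord F ν M g K k) {W W' : MSField (F.P K) (SU N)} (h : ∀ i, i ≤ k → W i = W' i) :
    UbgMSCoPOfRecordAtB F N ν M g K k Ω₀ s W = UbgMSCoPOfRecordAtB F N ν M g K k Ω₀ s W' := by
  rw [UbgMSCoPOfRecordAtB_apply, UbgMSCoPOfRecordAtB_apply]
  exact UminOfRecordB_lamBondsSeq_congr_of_agree_le _ _ s.Ω k h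

/-- **★ (BL) FOR def-R's PRINT-DATUM BACKGROUND OF RECORD** (support `Ω₀(s)`): print-datum twin of `UbgMSCoPOfRecord_congr_of_agree_le` (FLAG №16 ∕ LOCATE-HSEAM 5d3298b8d191f169;
the (b)-instance stays landed and true on its own text). [cite: Balaban1988Convergent, (2.12)–(2.13) pp.256–257; Balaban1985Variational, (2), (5)–(6) p.278; Balaban1984PropagatorsII, (2.3) p.224] -/
theorem UbgMSCoPOfRecordB_congr_of_agree_le (ν : Stage7Numerics) (M : ℕ) (g : ℕ → ℝ) (K k : ℕ) (s : SeqOfRecord F ν M g K k)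
    {W W' : MSField (F.P K) (SU N)} (h : ∀ i, i ≤ k → W i = W' i) :
    UbgMSCoPOfRecordB F N ν M g K k s W = UbgMSCoPOfRecordB F N ν M g K k s W' := by
  rw [UbgMSCoPOfRecordB_apply, UbgMSCoPOfRecordB_apply]
  exact UminOfRecordB_lamBondsSeq_congr_of_agree_le _ _ s.Ω k h

/-- **★ (BL) FOR node00-def-T's BACKGROUND OF RECORD AT EVERY LEVEL**: `UbgOfRecord₁₃CoP θ p n s 𝐖` reads `𝐖` at the scales `≤ n` only (level `0`: the fine field
`𝐖 0`; level `n+1`: def-R's background of record). [cite: Balaban1988Convergent, (2.12)–(2.13) pp.256–257, §2 p.258] -/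
theorem UbgOfRecord₁₃CoP_congr_of_agree_le (θ : Stage13Params F N) (p : B12.RunParams) :
    ∀ (n : ℕ) (s : SeqOfRecord F θ.ν θ.τ9.M (gOfRecord₁₃ F N θ p) p.K n) {W W' : MSField (F.P p.K) (SU N)},
      (∀ i, i ≤ n → W i = W' i) → UbgOfRecord₁₃CoP F N θ p n s W = UbgOfRecord₁₃CoP F N θ p n s W'
  | 0, s, W, W', h => by
      rw [UbgOfRecord₁₃CoP_zero]
      exact h 0 le_rfl
  | n + 1, s, W, W', h => by
      -- Stage-2 SEAM-ROBUST (WORKPLAN-IIIB, director-ym №343): (b)-datum background before the `Record13CoP` seam edit, print-datum background after it; (BL) holds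
      -- for both (above), so this proof elaborates in either state of the tree.
      rw [UbgOfRecord₁₃CoP_succ]
      apply_rules only [h, UbgMSCoPOfRecord_congr_of_agree_le, UbgMSCoPOfRecordB_congr_of_agree_le]

end Background

end Summit.QuantumFields.YangMills.Theorems.BalabanUVNodesN11BackgroundScaleLocal

end
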